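import Summits.Ventures.LatticeQCDFlow.Scoring.SU2TorusPlaquetteLimit
import Summits.Ventures.LatticeQCDFlow.Scoring.SU2TorusPlaquetteEnclosures
import HarnessLib

/-!
# SU(2) on the 2-torus: the free energy `log Z_{(ℤ/L)²}(β) = L²·log(e^{−2β} I₁(2β)/β) + O(r^{L²−1})` and its thermodynamic limit

HONEST FRAMING: exact (Metropolis-corrected) sampling algorithms for lattice gauge theory;
figures of merit are autocorrelation/cost numbers at stated couplings and volumes; no
continuum-physics claim.

Venture `LatticeQCDFlow` (cell pub-lqcd), sub-topic `Scoring`; FANOUT row 5 (`s0-sun-a`), GEN-12.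
NEW WORK of the cell (placement rule); the free-energy companion of GEN-10's
`SU2TorusPartitionFunction` (`Z_{(ℤ/L)²}^{SU(2)}(β) = Σ_n λ_n^{L²}`, `λ_n = e^{−2β}(I_n(2β) − I_{n+2}(2β))/(n+1)
= e^{−2β} I_{n+1}(2β)/β`) and `SU2TorusPlaquetteFiniteVolume`.

* `tsum_pow_mem_of_antitone`, `log_tsum_pow_sub_mem` — abstract: for antitone positive summable `w` and
  `V ≥ 1`, `w_0^V ≤ Σ_n w_n^V ≤ w_0^V (1 + (w_1/w_0)^{V−1} (Σ_n w_{n+1})/w_0)`, hence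
  `0 ≤ log Σ_n w_n^V − V log w_0 ≤ (w_1/w_0)^{V−1} (Σ_n w_{n+1})/w_0`;
* **`log_partitionFunction_su2_two_sub_mem`** — for `β > 0` and every `L ≥ 1`:
  `0 ≤ log Z_{(ℤ/L)²}(β) − L²·log(e^{−2β} I₁(2β)/β) ≤ (I₂(2β)/I₁(2β))^{L²−1} · Σ_n I_{n+2}(2β)/I₁(2β)`
  (ELEMENTARY form `_explicit`: `≤ (e^β − 1)(β/2)^{L²−1}`): the free energy is EXTENSIVE up to a correction
  exponentially small in the volume — `log Z = L² log λ_0 + log(1 + Σ_{n≥1}(λ_n/λ_0)^{L²})`;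
* **`tendsto_log_partitionFunction_su2_two_div_sq`** — the free energy density exists:
  `log Z_{(ℤ/(L+1))²}(β) / (L+1)² → log(e^{−2β} I₁(2β)/β) = −2β + log(I₁(2β)/β)` as `L → ∞`
  (`log_charCoeff_zero`).

Dictionary to the cell's tables: the reference table's `logZ` (row 5 ORACLE-TABLE / X02, weight
`e^{(b/2) tr U_p}`, `b = 2β`) is `log Z + 2βL² = L² log(I₁(b)/(b/2)) + (the same remainder)`; e.g. `b = 2.2`,
`16²`: `256·log(I₁(2.2)/1.1) = 141.8072483…` (table `141.807248312516…`, remainder `< 10⁻⁸⁰`).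
Elementary given GEN-10; nothing is cited; no `def`.
-/

noncomputable section

open Real MeasureTheory Set Function Finset Filter Topology Polynomial.Chebyshev
open Literature.MathematicalPhysics.QuantumFieldTheory Literature.MathematicalPhysics.QuantumLattice
open Literature.Analysis.FunctionSpaces
open Summit.Ventures.LatticeQCDFlow.Exactness
open Summit.Ventures.LatticeQCDFlow.Theory2.Lattice

namespace Summit.Ventures.LatticeQCDFlow.Scoring

/-! ## §1. The abstract estimates -/

section Abstract

variable {w : ℕ → ℝ} (hanti : Antitone w) (hpos : ∀ n, 0 < w n) (hsum : Summable w)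
include hanti hpos hsum

/-- **`w_0^V ≤ Σ_n w_n^V ≤ w_0^V·(1 + (w_1/w_0)^{V−1}·(Σ_n w_{n+1})/w_0)`** for an antitone, positive,
summable `w` and `V ≥ 1` (`w_n^V ≤ w_1^{V−1} w_n` for `n ≥ 1`). -/
theorem tsum_pow_mem_of_antitone (V : ℕ) (hV : 1 ≤ V) :
    w 0 ^ V ≤ ∑' n : ℕ, w n ^ V ∧
      ∑' n : ℕ, w n ^ V ≤ w 0 ^ V * (1 + (w 1 / w 0) ^ (V - 1) * ((∑' n : ℕ, w (n + 1)) / w 0)) := by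
  obtain ⟨v, rfl⟩ : ∃ v, V = v + 1 := ⟨V - 1, by omega⟩
  simp only [Nat.add_sub_cancel]
  have hw0 := hpos 0
  have hw1 := hpos 1
  have hsumZ : Summable fun n => w n ^ (v + 1) := summable_pow_of_antitone hanti hpos hsum _ (by omega)
  have hsumS : Summable fun n => w (n + 1) := (summable_nat_add_iff 1).mpr hsum
  have hsumZtail : Summable fun n => w (n + 1) ^ (v + 1) := (summable_nat_add_iff 1).mpr hsumZ
  refine ⟨hsumZ.le_tsum 0 (fun j _ => pow_nonneg (hpos j).le _), ?_⟩
  rw [hsumZ.tsum_eq_zero_add]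
  have htail : ∑' n, w (n + 1) ^ (v + 1) ≤ w 1 ^ v * ∑' n, w (n + 1) := by
    rw [← tsum_mul_left]
    refine hsumZtail.tsum_le_tsum (fun n => ?_) (hsumS.mul_left _)
    rw [pow_succ]
    exact mul_le_mul_of_nonneg_right (pow_le_pow_left₀ (hpos (n + 1)).le (hanti (by omega)) _)
      (hpos (n + 1)).le
  have hw1e : w 1 ^ v = (w 1 / w 0) ^ v * w 0 ^ v := by
    rw [div_pow, div_mul_cancel₀]
    positivity
  have heq : w 0 ^ (v + 1) * (1 + (w 1 / w 0) ^ v * ((∑' n : ℕ, w (n + 1)) / w 0)) =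
      w 0 ^ (v + 1) + w 1 ^ v * ∑' n, w (n + 1) := by
    rw [hw1e, pow_succ]
    field_simp
  rw [heq]
  linarith

/-- **`0 ≤ log(Σ_n w_n^V) − V·log w_0 ≤ (w_1/w_0)^{V−1}·(Σ_n w_{n+1})/w_0`** (`log(1 + x) ≤ x`). -/
theorem log_tsum_pow_sub_mem (V : ℕ) (hV : 1 ≤ V) :
    0 ≤ Real.log (∑' n : ℕ, w n ^ V) - V * Real.log (w 0) ∧
      Real.log (∑' n : ℕ, w n ^ V) - V * Real.log (w 0) ≤
        (w 1 / w 0) ^ (V - 1) * ((∑' n : ℕ, w (n + 1)) / w 0) := by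
  obtain ⟨hlo, hhi⟩ := tsum_pow_mem_of_antitone hanti hpos hsum V hV
  set Z : ℝ := ∑' n : ℕ, w n ^ V with hZ
  set x : ℝ := (w 1 / w 0) ^ (V - 1) * ((∑' n : ℕ, w (n + 1)) / w 0) with hx
  have hw0 := hpos 0
  have hw0V : 0 < w 0 ^ V := pow_pos hw0 _
  have hZpos : 0 < Z := lt_of_lt_of_le hw0V hlo
  have hx0 : 0 ≤ x := by
    have : 0 ≤ ∑' n : ℕ, w (n + 1) := tsum_nonneg fun n => (hpos _).le
    have := (hpos 1).le
    positivity
  have hlog : Real.log Z - V * Real.log (w 0) = Real.log (Z / w 0 ^ V) := by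
    rw [Real.log_div hZpos.ne' hw0V.ne', Real.log_pow]
  rw [hlog]
  have hq1 : 1 ≤ Z / w 0 ^ V := by rwa [le_div_iff₀ hw0V, one_mul]
  have hq2 : Z / w 0 ^ V ≤ 1 + x := by
    rw [div_le_iff₀ hw0V]
    linarith
  refine ⟨Real.log_nonneg hq1, ?_⟩
  have := Real.log_le_sub_one_of_pos (lt_of_lt_of_le one_pos hq1)
  linarith

end Abstract

/-! ## §2. The SU(2) torus free energy -/

/-- `log λ_0 = log(e^{−2β} I₁(2β)/β) = −2β + log(I₁(2β)/β)` (`β > 0`). -/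
theorem log_charCoeff_zero {β : ℝ} (hβ : 0 < β) :
    Real.log (Real.exp (-(2 * β)) * besselI 1 (2 * β) / β) = -(2 * β) + Real.log (besselI 1 (2 * β) / β) := by
  have hI1 : 0 < besselI 1 (2 * β) := besselI_pos 1 (by linarith)
  rw [mul_div_assoc, Real.log_mul (Real.exp_pos _).ne' (div_pos hI1 hβ).ne', Real.log_exp]

/-- **THE FREE ENERGY OF 2-d SU(2) ON THE TORUS IS EXTENSIVE UP TO AN EXPONENTIALLY SMALL CORRECTION.**
For `β > 0` and every `L ≥ 1`:
`0 ≤ log Z_{(ℤ/L)²}(β) − L²·log(e^{−2β} I₁(2β)/β) ≤ (I₂(2β)/I₁(2β))^{L²−1} · Σ_n I_{n+2}(2β)/I₁(2β)`. -/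
theorem log_partitionFunction_su2_two_sub_mem {L : ℕ} [NeZero L] {β : ℝ} (hβ : 0 < β) :
    0 ≤ Real.log (partitionFunction (d := 2) (L := L) (fundamentalRep (Fin 2)) β).toReal -
        (L ^ 2 : ℕ) * Real.log (Real.exp (-(2 * β)) * besselI 1 (2 * β) / β) ∧
      Real.log (partitionFunction (d := 2) (L := L) (fundamentalRep (Fin 2)) β).toReal -
          (L ^ 2 : ℕ) * Real.log (Real.exp (-(2 * β)) * besselI 1 (2 * β) / β) ≤
        (besselI 2 (2 * β) / besselI 1 (2 * β)) ^ (L ^ 2 - 1) *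
          ((∑' n : ℕ, besselI (n + 2) (2 * β)) / besselI 1 (2 * β)) := by
  set w : ℕ → ℝ := fun n => Real.exp (-(2 * β)) * (besselI n (2 * β) - besselI (n + 2) (2 * β)) /
    ((n : ℝ) + 1) with hw
  have hanti : Antitone w := charCoeff_div_succ_antitone hβ
  have hpos : ∀ n, 0 < w n := charCoeff_div_succ_pos hβ
  have hsum : Summable w := summable_charCoeff_div_succ hβ.le
  have hV : 1 ≤ L ^ 2 := Nat.one_le_pow _ _ (Nat.pos_of_ne_zero (NeZero.ne L))
  have habs := log_tsum_pow_sub_mem hanti hpos hsum (L ^ 2) hV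
  have hw' : ∀ n, w n = Real.exp (-(2 * β)) * besselI (n + 1) (2 * β) / β := fun n =>
    charCoeff_div_succ_eq_besselI n hβ.ne'
  have hI1 : 0 < besselI 1 (2 * β) := besselI_pos 1 (by linarith)
  have he : 0 < Real.exp (-(2 * β)) := Real.exp_pos _
  have hratio : w 1 / w 0 = besselI 2 (2 * β) / besselI 1 (2 * β) := by
    rw [hw' 1, hw' 0]
    field_simp
  have hS : (∑' n : ℕ, w (n + 1)) / w 0 = (∑' n : ℕ, besselI (n + 2) (2 * β)) / besselI 1 (2 * β) := by
    have h1 : (fun n : ℕ => w (n + 1)) = fun n => (Real.exp (-(2 * β)) / β) * besselI (n + 2) (2 * β) := by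
      funext n; rw [hw' (n + 1)]; ring
    rw [h1, tsum_mul_left, hw' 0]
    field_simp
  have hw0 : w 0 = Real.exp (-(2 * β)) * besselI 1 (2 * β) / β := by rw [hw' 0]
  rw [partitionFunction_su2_two_toReal_eq_tsum hβ.le, ← hw0, ← hratio, ← hS]
  exact habs

/-- **ELEMENTARY EXPLICIT FORM**: for `β > 0` and every `L ≥ 1`,
`0 ≤ log Z_{(ℤ/L)²}(β) − L²·log(e^{−2β} I₁(2β)/β) ≤ (e^β − 1)·(β/2)^{L²−1}`. -/
theorem log_partitionFunction_su2_two_sub_mem_explicit {L : ℕ} [NeZero L] {β : ℝ} (hβ : 0 < β) :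
    0 ≤ Real.log (partitionFunction (d := 2) (L := L) (fundamentalRep (Fin 2)) β).toReal -
        (L ^ 2 : ℕ) * Real.log (Real.exp (-(2 * β)) * besselI 1 (2 * β) / β) ∧
      Real.log (partitionFunction (d := 2) (L := L) (fundamentalRep (Fin 2)) β).toReal -
          (L ^ 2 : ℕ) * Real.log (Real.exp (-(2 * β)) * besselI 1 (2 * β) / β) ≤
        (Real.exp β - 1) * (β / 2) ^ (L ^ 2 - 1) := by
  obtain ⟨h0, h⟩ := log_partitionFunction_su2_two_sub_mem (L := L) hβ
  refine ⟨h0, h.trans ?_⟩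
  have hx : (0 : ℝ) ≤ 2 * β := by linarith
  have hI1 : 0 < besselI 1 (2 * β) := besselI_pos 1 (by linarith)
  have hr : besselI 2 (2 * β) / besselI 1 (2 * β) ≤ β / 2 := by
    rw [div_le_iff₀ hI1]
    have := besselI_succ_le_div_mul 1 hx
    calc besselI 2 (2 * β) ≤ 2 * β / (2 * ((1 : ℕ) + 1)) * besselI 1 (2 * β) := this
      _ = β / 2 * besselI 1 (2 * β) := by push_cast; ring
  have hr0 : 0 ≤ besselI 2 (2 * β) / besselI 1 (2 * β) := div_nonneg (besselI_nonneg 2 hx) hI1.le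
  obtain ⟨_, hS⟩ := tsum_besselI_add_two_le hx
  have hS' : (∑' n : ℕ, besselI (n + 2) (2 * β)) / besselI 1 (2 * β) ≤ Real.exp β - 1 := by
    rw [div_le_iff₀ hI1]
    have h2 : 2 * β / 2 = β := by ring
    rw [h2] at hS
    exact hS
  have hS0 : 0 ≤ (∑' n : ℕ, besselI (n + 2) (2 * β)) / besselI 1 (2 * β) :=
    div_nonneg (tsum_nonneg fun n => besselI_nonneg _ hx) hI1.le
  calc (besselI 2 (2 * β) / besselI 1 (2 * β)) ^ (L ^ 2 - 1) *
        ((∑' n : ℕ, besselI (n + 2) (2 * β)) / besselI 1 (2 * β))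
      ≤ (β / 2) ^ (L ^ 2 - 1) * (Real.exp β - 1) :=
        mul_le_mul (pow_le_pow_left₀ hr0 hr _) hS' hS0 (by positivity)
    _ = _ := mul_comm _ _

/-! ## §3. The free energy density -/

/-- **THE FREE ENERGY DENSITY OF 2-d SU(2) LATTICE YANG–MILLS EXISTS AND IS `log(e^{−2β} I₁(2β)/β)`.**
For `β > 0`, `log Z_{(ℤ/(L+1))²}(β) / (L+1)² → log(e^{−2β} I₁(2β)/β)` as `L → ∞`. -/
theorem tendsto_log_partitionFunction_su2_two_div_sq {β : ℝ} (hβ : 0 < β) :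
    Tendsto (fun L : ℕ => Real.log (partitionFunction (d := 2) (L := L + 1) (fundamentalRep (Fin 2)) β).toReal /
        ((((L + 1) ^ 2 : ℕ) : ℝ))) atTop (𝓝 (Real.log (Real.exp (-(2 * β)) * besselI 1 (2 * β) / β))) := by
  obtain ⟨hr0, hr1⟩ := besselI_two_div_one_lt_one hβ
  set r : ℝ := besselI 2 (2 * β) / besselI 1 (2 * β) with hr
  set K : ℝ := (∑' n : ℕ, besselI (n + 2) (2 * β)) / besselI 1 (2 * β) with hK
  set f : ℝ := Real.log (Real.exp (-(2 * β)) * besselI 1 (2 * β) / β) with hf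
  have hK0 : 0 ≤ K := div_nonneg (tsum_nonneg fun n => besselI_nonneg _ (by linarith))
    (besselI_pos 1 (by linarith)).le
  have hexp : Tendsto (fun L : ℕ => (L + 1) ^ 2 - 1) atTop atTop := by
    refine tendsto_atTop_mono (fun L => ?_) tendsto_id
    have : (L + 1) ^ 2 = L * L + 2 * L + 1 := by ring
    simp only [id_eq]
    omega
  have hpow : Tendsto (fun L : ℕ => r ^ ((L + 1) ^ 2 - 1)) atTop (𝓝 0) :=
    (tendsto_pow_atTop_nhds_zero_of_lt_one hr0 hr1).comp hexp
  have hbound : Tendsto (fun L : ℕ => r ^ ((L + 1) ^ 2 - 1) * K) atTop (𝓝 0) := by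
    simpa using hpow.mul_const K
  rw [tendsto_iff_norm_sub_tendsto_zero]
  refine squeeze_zero (fun L => norm_nonneg _) (fun L => ?_) hbound
  rw [Real.norm_eq_abs]
  obtain ⟨h0, h1⟩ := log_partitionFunction_su2_two_sub_mem (L := L + 1) hβ
  have hV : (0 : ℝ) < (((L + 1) ^ 2 : ℕ) : ℝ) := by positivity
  have hV1 : (1 : ℝ) ≤ (((L + 1) ^ 2 : ℕ) : ℝ) := by
    have : 1 ≤ (L + 1) ^ 2 := Nat.one_le_pow _ _ (Nat.succ_pos L)
    exact_mod_cast this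
  have hkey : Real.log (partitionFunction (d := 2) (L := L + 1) (fundamentalRep (Fin 2)) β).toReal /
      (((L + 1) ^ 2 : ℕ) : ℝ) - f =
      (Real.log (partitionFunction (d := 2) (L := L + 1) (fundamentalRep (Fin 2)) β).toReal -
        (((L + 1) ^ 2 : ℕ) : ℝ) * f) / (((L + 1) ^ 2 : ℕ) : ℝ) := by
    field_simp
  rw [hkey, abs_div, abs_of_pos hV, abs_of_nonneg h0, div_le_iff₀ hV]
  calc _ ≤ r ^ ((L + 1) ^ 2 - 1) * K := h1
    _ = r ^ ((L + 1) ^ 2 - 1) * K * 1 := (mul_one _).symm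
    _ ≤ r ^ ((L + 1) ^ 2 - 1) * K * (((L + 1) ^ 2 : ℕ) : ℝ) :=
        mul_le_mul_of_nonneg_left hV1 (by positivity)

end Summit.Ventures.LatticeQCDFlow.Scoring
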